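import Summits.RiemannHypothesis.RiemannHypothesis.Theorems.MotivicDoorFfFibre

/-!
# Motivic door, function-field side (C)(i), part 5b: THE HONEST FIBRE IS A LATTICE; full-fibre density
(pub-rhdoor seat ff-1.  HONEST FRAMING: lottery ticket at the motivic door; RH probability negligible; consolation
prizes are real: a new semi-local Weil-positivity theorem, or a located gap in the Connes–Consani programme, plus the
ff-door theorem.  No claim about `ζ`; "RH(q,h)" is `|α| = √q` for the complex roots of ONE integer polynomial `h`.)

Continuation of part 5a (`MotivicDoorFfFibre`: a window `T_M` sees exactly the top `M` coefficients).  PROVED here: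

* §4 THE HONEST FIBRE IS AN AFFINE LATTICE OF RANK `g - M`: on honest data (monic, degree `2g`, coefficient FE —
  typed INLINE) the fibre `{h' honest : T_M(q,h') = T_M(q,h)}` for `M + 1 ≤ g`, `q > 0`, is put in BIJECTION with
  `ℤ^{(M,g]}` by the readout `h' ↦ (c_{2g-k}(h'))_{M<k≤g}` (`fibre_bijOn_readout`): injective by the window
  (top `M` coefficients), the readout, and the FE reflecting the upper half of the coefficients onto the lower
  (`eq_of_fe_of_coeff_eq_upper`); surjective by the explicit FE-symmetric FIBRE SHIFT
  `fibreShift[q,g,M,a] = Σ_{M<k<g} a_k (x^{2g-k} + q^{g-k} x^k) + a_g x^g` (file-local notation for that explicit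
  sum; `fe_fibreShift`, `coeff_fibreShift_eq_zero`, `coeff_fibreShift_readout`, `fibreShift_honest`).  For
  `M ≥ g` the fibre is the point `{h}` (Handover,
  `eq_of_weilWindowForm_eq_of_fe`) — so the honest fibre of the window prefix of depth `M` has rank exactly
  `max(g - M, 0)`: ffmirror-1's dial (rank 1) was the case `k = g` of the shift.
* §5 FULL-FIBRE DENSITY = door (i), finite-window half, final form: the honest fibre is INFINITE
  (`fibre_infinite`), its RH-true part FINITE (`fibre_ffRH_finite`, readout in the Weil box
  `abs_readout_le_of_ffRH`), and a depth-`M` reader accepting one member accepts all (`finiteWindow_accepts_fibre`);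
  hence (`ffDoor_fibre_density`) a window-local predicate of depth `M < g` that accepts ONE honest datum accepts
  INFINITELY MANY honest RH-false data with the very same windows `T_0, …, T_M`, and the accepted-honest-RH-false
  members are all but finitely many of the fibre (`finiteWindow_fibre_fakes_cofinite`).  With part 2's scale-free
  dichotomy (`ffDoor_scaleFree`) this is statement (i) with its quantifiers in final position: "matched by honest
  fakes" holds fibre by fibre, with density one in each fibre `≅ ℤ^{g-M}`, at EVERY depth `M < g`.

[folklore] throughout (linear algebra of the FE-symmetric coefficient space, Weil box).  Nothing here is, or
implies, a statement about `ζ`.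
-/

set_option linter.dupNamespace false

noncomputable section

open Polynomial

open Summit.RiemannHypothesis.RiemannHypothesis.Theorems.PfPersistence.FfAngleTwin

namespace Summit.RiemannHypothesis.RiemannHypothesis.Theorems.MotivicDoor.FunctionField

/-! ## 4. The honest fibre and its rank-`(g - M)` parametrisation -/

/-- Two honest data (degree `2g`, coefficient FE) with the same UPPER-half coefficients `c_g, …, c_{2g}` are equal:
the FE reflects the upper half onto the lower (`q > 0`). [folklore] -/
theorem eq_of_fe_of_coeff_eq_upper {q : ℕ} (hq : 0 < q) {h h' : ℤ[X]} {g : ℕ}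
    (hdeg : h.natDegree = 2 * g) (hdeg' : h'.natDegree = 2 * g)
    (hFE : ∀ i j, i + j = 2 * g → (q : ℤ) ^ g * h.coeff j = (q : ℤ) ^ i * h.coeff i)
    (hFE' : ∀ i j, i + j = 2 * g → (q : ℤ) ^ g * h'.coeff j = (q : ℤ) ^ i * h'.coeff i)
    (hc : ∀ i, g ≤ i → i ≤ 2 * g → h.coeff i = h'.coeff i) : h = h' := by
  ext i
  by_cases hi2 : i ≤ 2 * g
  · by_cases hgi : g ≤ i
    · exact hc i hgi hi2
    · have h1 := hFE (2 * g - i) i (by omega)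
      have h2 := hFE' (2 * g - i) i (by omega)
      rw [hc (2 * g - i) (by omega) (by omega), ← h2] at h1
      exact mul_left_cancel₀ (pow_ne_zero _ (by exact_mod_cast hq.ne')) h1
  · rw [coeff_eq_zero_of_natDegree_lt (by omega), coeff_eq_zero_of_natDegree_lt (by omega)]

/-- FE is additive … [folklore] -/
theorem fe_add {q : ℕ} {g : ℕ} {h r : ℤ[X]}
    (hh : ∀ i j, i + j = 2 * g → (q : ℤ) ^ g * h.coeff j = (q : ℤ) ^ i * h.coeff i)
    (hr : ∀ i j, i + j = 2 * g → (q : ℤ) ^ g * r.coeff j = (q : ℤ) ^ i * r.coeff i) :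
    ∀ i j, i + j = 2 * g → (q : ℤ) ^ g * (h + r).coeff j = (q : ℤ) ^ i * (h + r).coeff i := by
  intro i j hij
  rw [coeff_add, coeff_add, mul_add, mul_add, hh i j hij, hr i j hij]

/-- … homogeneous … [folklore] -/
theorem fe_C_mul {q : ℕ} {g : ℕ} {r : ℤ[X]} (c : ℤ)
    (hr : ∀ i j, i + j = 2 * g → (q : ℤ) ^ g * r.coeff j = (q : ℤ) ^ i * r.coeff i) :
    ∀ i j, i + j = 2 * g → (q : ℤ) ^ g * (C c * r).coeff j = (q : ℤ) ^ i * (C c * r).coeff i := by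
  intro i j hij
  rw [coeff_C_mul, coeff_C_mul, mul_left_comm, hr i j hij, mul_left_comm]

/-- … and closed under finite sums. [folklore] -/
theorem fe_sum {q : ℕ} {g : ℕ} {ι : Type*} (s : Finset ι) (f : ι → ℤ[X])
    (hf : ∀ k ∈ s, ∀ i j, i + j = 2 * g → (q : ℤ) ^ g * (f k).coeff j = (q : ℤ) ^ i * (f k).coeff i) :
    ∀ i j, i + j = 2 * g →
      (q : ℤ) ^ g * (∑ k ∈ s, f k).coeff j = (q : ℤ) ^ i * (∑ k ∈ s, f k).coeff i := by
  classical
  induction s using Finset.induction_on with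
  | empty => intro i j _; simp
  | insert a s ha ih =>
    rw [Finset.sum_insert ha]
    exact fe_add (hf a (Finset.mem_insert_self a s)) (ih fun k hk => hf k (Finset.mem_insert_of_mem hk))

/-- The middle monomial `x^g` satisfies the FE. [folklore] -/
theorem fe_X_pow_middle (q g : ℕ) :
    ∀ i j, i + j = 2 * g →
      (q : ℤ) ^ g * (X ^ g : ℤ[X]).coeff j = (q : ℤ) ^ i * (X ^ g : ℤ[X]).coeff i := by
  intro i j hij
  rw [coeff_X_pow, coeff_X_pow]
  by_cases hj : j = g
  · rw [if_pos hj, if_pos (show i = g by omega), show i = g by omega]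
  · rw [if_neg hj, if_neg (show ¬ i = g by omega), mul_zero, mul_zero]

/-- The FE-symmetric binomials `x^{2g-k} + q^{g-k} x^k` (`k < g`) satisfy the FE. [folklore] -/
theorem fe_symm_binomial (q : ℕ) {g k : ℕ} (hk : k < g) :
    ∀ i j, i + j = 2 * g →
      (q : ℤ) ^ g * (X ^ (2 * g - k) + C ((q : ℤ) ^ (g - k)) * X ^ k : ℤ[X]).coeff j
        = (q : ℤ) ^ i * (X ^ (2 * g - k) + C ((q : ℤ) ^ (g - k)) * X ^ k : ℤ[X]).coeff i := by
  intro i j hij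
  simp only [coeff_add, coeff_X_pow, coeff_C_mul_X_pow]
  by_cases hj1 : j = 2 * g - k
  · have hi : i = k := by omega
    have hjk : ¬ j = k := by omega
    have hik : ¬ i = 2 * g - k := by omega
    rw [if_pos hj1, if_neg hjk, if_neg hik, if_pos hi, add_zero, zero_add, mul_one, ← pow_add, hi,
      show k + (g - k) = g by omega]
  · by_cases hj2 : j = k
    · have hi : i = 2 * g - k := by omega
      have hik : ¬ i = k := by omega
      rw [if_neg hj1, if_pos hj2, if_pos hi, if_neg hik, zero_add, add_zero, mul_one, ← pow_add, hi,
        show g + (g - k) = 2 * g - k by omega]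
    · have hik : ¬ i = k := by omega
      have hik' : ¬ i = 2 * g - k := by omega
      rw [if_neg hj1, if_neg hj2, if_neg hik', if_neg hik, add_zero, mul_zero, mul_zero]

/-! THE FIBRE SHIFT `fibreShift[q, g, M, a] = Σ_{M<k<g} a_k (x^{2g-k} + q^{g-k} x^k) + a_g x^g`: the FE-symmetric
perturbation supported on the coefficients a depth-`M` window cannot see.  It is file-local NOTATION for an
explicit integer polynomial (not a declaration), so every theorem below is a statement about that explicit sum. -/
local notation "fibreShift[" q ", " g ", " M ", " a "]" =>
  ((∑ k ∈ Finset.Ioo M g, C (a k) * (X ^ (2 * g - k) + C ((q : ℤ) ^ (g - k)) * X ^ k)) + C (a g) * X ^ g : ℤ[X])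

/-- The fibre shift satisfies the FE. [folklore] -/
theorem fe_fibreShift (q g M : ℕ) (a : ℕ → ℤ) :
    ∀ i j, i + j = 2 * g →
      (q : ℤ) ^ g * (fibreShift[q, g, M, a]).coeff j = (q : ℤ) ^ i * (fibreShift[q, g, M, a]).coeff i := by
  exact fe_add (fe_sum _ _ fun k hk => fe_C_mul (a k) (fe_symm_binomial q (Finset.mem_Ioo.1 hk).2))
    (fe_C_mul (a g) (fe_X_pow_middle q g))

/-- The fibre shift is invisible at depth `M`: its coefficients `c_n`, `n ≥ 2g - M`, vanish (`M + 1 ≤ g`).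
[folklore] -/
theorem coeff_fibreShift_eq_zero (q : ℕ) {g M : ℕ} (hM : M + 1 ≤ g) (a : ℕ → ℤ) {n : ℕ}
    (hn : 2 * g - M ≤ n) : (fibreShift[q, g, M, a]).coeff n = 0 := by
  rw [coeff_add, finsetSum_coeff, Finset.sum_eq_zero, coeff_C_mul_X_pow,
    if_neg (show ¬ n = g by omega), zero_add]
  intro k hk
  rw [Finset.mem_Ioo] at hk
  rw [coeff_C_mul, coeff_add, coeff_X_pow, coeff_C_mul_X_pow, if_neg (show ¬ n = 2 * g - k by omega),
    if_neg (show ¬ n = k by omega), add_zero, mul_zero]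

/-- The fibre shift READS OUT its parameters: `c_{2g-k'}(fibreShift a) = a_{k'}` for `M < k' ≤ g`. [folklore] -/
theorem coeff_fibreShift_readout (q : ℕ) {g M : ℕ} (a : ℕ → ℤ) {k' : ℕ} (hk1 : M < k') (hk2 : k' ≤ g) :
    (fibreShift[q, g, M, a]).coeff (2 * g - k') = a k' := by
  rw [coeff_add, finsetSum_coeff, coeff_C_mul_X_pow]
  rcases hk2.lt_or_eq with hlt | heq
  · -- `k' < g`: the binomial of index `k'` contributes `a k'`, nothing else contributes
    rw [Finset.sum_eq_single_of_mem k' (Finset.mem_Ioo.2 ⟨hk1, hlt⟩), if_neg (show ¬ 2 * g - k' = g by omega),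
      add_zero, coeff_C_mul, coeff_add, coeff_X_pow, coeff_C_mul_X_pow, if_pos rfl,
      if_neg (show ¬ 2 * g - k' = k' by omega), add_zero, mul_one]
    intro k hk hkk'
    rw [Finset.mem_Ioo] at hk
    rw [coeff_C_mul, coeff_add, coeff_X_pow, coeff_C_mul_X_pow, if_neg (show ¬ 2 * g - k' = 2 * g - k by omega),
      if_neg (show ¬ 2 * g - k' = k by omega), add_zero, mul_zero]
  · -- `k' = g`: only the middle term contributes
    rw [heq, show 2 * g - g = g by omega, if_pos rfl, Finset.sum_eq_zero, zero_add]
    intro k hk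
    rw [Finset.mem_Ioo] at hk
    rw [coeff_C_mul, coeff_add, coeff_X_pow, coeff_C_mul_X_pow, if_neg (show ¬ g = 2 * g - k by omega),
      if_neg (show ¬ g = k by omega), add_zero, mul_zero]

/-- … so it has degree `< 2g` (`M + 1 ≤ g`). [folklore] -/
theorem natDegree_fibreShift_lt (q : ℕ) {g M : ℕ} (hM : M + 1 ≤ g) (a : ℕ → ℤ) :
    (fibreShift[q, g, M, a]).natDegree < 2 * g := by
  have h : (fibreShift[q, g, M, a]).natDegree ≤ 2 * g - M - 1 := by
    rw [Polynomial.natDegree_le_iff_coeff_eq_zero]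
    intro N hN
    exact coeff_fibreShift_eq_zero q hM a (by omega)
  omega

/-- Adding a fibre shift to an honest datum gives an honest datum with the SAME window `T_M` and PRESCRIBED
invisible coefficients `c_{2g-k} = c_{2g-k}(h) + a_k`, `M < k ≤ g`. [folklore] -/
theorem fibreShift_honest {q : ℕ} {g M : ℕ} (hM : M + 1 ≤ g) {h : ℤ[X]} (hh : h.Monic)
    (hdeg : h.natDegree = 2 * g)
    (hFE : ∀ i j, i + j = 2 * g → (q : ℤ) ^ g * h.coeff j = (q : ℤ) ^ i * h.coeff i) (a : ℕ → ℤ) :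
    (h + fibreShift[q, g, M, a]).Monic ∧ (h + fibreShift[q, g, M, a]).natDegree = 2 * g ∧
      (∀ i j, i + j = 2 * g → (q : ℤ) ^ g * (h + fibreShift[q, g, M, a]).coeff j
        = (q : ℤ) ^ i * (h + fibreShift[q, g, M, a]).coeff i) ∧
      weilWindowForm (q : ℝ) (h + fibreShift[q, g, M, a]) M = weilWindowForm (q : ℝ) h M ∧
      ∀ k, M < k → k ≤ g → (h + fibreShift[q, g, M, a]).coeff (2 * g - k) = h.coeff (2 * g - k) + a k := by
  have hlt : (fibreShift[q, g, M, a]).degree < h.degree := by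
    rw [degree_eq_natDegree hh.ne_zero, hdeg]
    exact degree_le_natDegree.trans_lt (by exact_mod_cast natDegree_fibreShift_lt q hM a)
  have hmon : (h + fibreShift[q, g, M, a]).Monic := hh.add_of_left hlt
  have hdeg' : (h + fibreShift[q, g, M, a]).natDegree = 2 * g := by
    rw [natDegree_add_eq_left_of_degree_lt hlt, hdeg]
  refine ⟨hmon, hdeg', fe_add hFE (fe_fibreShift q g M a), ?_, fun k hk1 hk2 => ?_⟩
  · refine weilWindowForm_eq_of_coeff_eq (q : ℝ) hmon hh (hdeg'.trans hdeg.symm) (fun k _ hkM hkd => ?_)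
      le_rfl
    rw [hdeg'] at hkd ⊢
    rw [coeff_add, coeff_fibreShift_eq_zero q hM a (by omega), add_zero]
  · rw [coeff_add, coeff_fibreShift_readout q a hk1 hk2]

/-- Members of a fibre share the top coefficients `c_i`, `i ≥ 2g - M` (plain form, `q > 0`). [folklore] -/
theorem coeff_eq_top_of_weilWindowForm_eq {q : ℝ} (hq : 0 < q) {h h' : ℤ[X]} {g M : ℕ} (hh : h.Monic)
    (hh' : h'.Monic) (hdeg : h.natDegree = 2 * g) (hdeg' : h'.natDegree = 2 * g)
    (hT : weilWindowForm q h' M = weilWindowForm q h M) {i : ℕ} (hi : 2 * g - M ≤ i) :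
    h'.coeff i = h.coeff i :=
  (weilWindowForm_eq_iff_coeff_eq_top hq hh hh' hdeg hdeg' M).1 hT i hi

/-- THE HONEST FIBRE IS `ℤ^{(M, g]}`: for an honest datum `h` of dimension `g ≥ M + 1` and `q > 0`, the readout
`h' ↦ (c_{2g-k}(h'))_{M < k ≤ g}` is a BIJECTION from the honest fibre `{h' honest : T_M(q,h') = T_M(q,h)}` onto
ALL of `ℤ^{(M,g]}` — injective by window + readout + FE, surjective by the fibre shift.  (For `M ≥ g` the fibre is
`{h}`: Handover `eq_of_weilWindowForm_eq_of_fe`.) [folklore] -/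
theorem fibre_bijOn_readout {q : ℕ} (hq : 0 < q) {g M : ℕ} (hM : M + 1 ≤ g) {h : ℤ[X]} (hh : h.Monic)
    (hdeg : h.natDegree = 2 * g)
    (hFE : ∀ i j, i + j = 2 * g → (q : ℤ) ^ g * h.coeff j = (q : ℤ) ^ i * h.coeff i) :
    Set.BijOn (fun h' : ℤ[X] => fun k : Finset.Ioc M g => h'.coeff (2 * g - k))
      {h' : ℤ[X] | h'.Monic ∧ h'.natDegree = 2 * g ∧
        (∀ i j, i + j = 2 * g → (q : ℤ) ^ g * h'.coeff j = (q : ℤ) ^ i * h'.coeff i) ∧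
        weilWindowForm (q : ℝ) h' M = weilWindowForm (q : ℝ) h M}
      Set.univ := by
  have hq' : (0 : ℝ) < q := Nat.cast_pos.mpr hq
  refine ⟨fun _ _ => Set.mem_univ _, ?_, ?_⟩
  · -- injective: window + readout give the upper half, the FE the rest
    rintro h₁ ⟨hh₁, hdeg₁, hFE₁, hT₁⟩ h₂ ⟨hh₂, hdeg₂, hFE₂, hT₂⟩ hb
    refine eq_of_fe_of_coeff_eq_upper hq hdeg₁ hdeg₂ hFE₁ hFE₂ fun i hgi hi2 => ?_
    by_cases hiM : 2 * g - M ≤ i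
    · rw [coeff_eq_top_of_weilWindowForm_eq hq' hh hh₁ hdeg hdeg₁ hT₁ hiM,
        coeff_eq_top_of_weilWindowForm_eq hq' hh hh₂ hdeg hdeg₂ hT₂ hiM]
    · have hk : 2 * g - i ∈ Finset.Ioc M g := Finset.mem_Ioc.2 ⟨by omega, by omega⟩
      have e : h₁.coeff (2 * g - (2 * g - i)) = h₂.coeff (2 * g - (2 * g - i)) :=
        congrFun hb ⟨2 * g - i, hk⟩
      rwa [show 2 * g - (2 * g - i) = i by omega] at e
  · -- surjective: shift the invisible coefficients
    intro b _
    obtain ⟨a, ha⟩ : ∃ a : ℕ → ℤ, ∀ k : Finset.Ioc M g, a k = b k - h.coeff (2 * g - k) :=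
      ⟨fun k => if hk : k ∈ Finset.Ioc M g then b ⟨k, hk⟩ - h.coeff (2 * g - k) else 0,
        fun k => by dsimp only; rw [dif_pos k.2]⟩
    obtain ⟨hmon, hdeg', hFE', hT, hread⟩ := fibreShift_honest hM hh hdeg hFE a
    refine ⟨h + fibreShift[q, g, M, a], ⟨hmon, hdeg', hFE', hT⟩, funext fun k => ?_⟩
    show (h + fibreShift[q, g, M, a]).coeff (2 * g - k) = b k
    rw [hread k (Finset.mem_Ioc.1 k.2).1 (Finset.mem_Ioc.1 k.2).2, ha k, add_sub_cancel]

/-! ## 5. Full-fibre density: door (i), finite-window half, final form -/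

/-- The honest fibre below the handover depth is INFINITE (`M + 1 ≤ g`, `q > 0`). [folklore] -/
theorem fibre_infinite {q : ℕ} (hq : 0 < q) {g M : ℕ} (hM : M + 1 ≤ g) {h : ℤ[X]} (hh : h.Monic)
    (hdeg : h.natDegree = 2 * g)
    (hFE : ∀ i j, i + j = 2 * g → (q : ℤ) ^ g * h.coeff j = (q : ℤ) ^ i * h.coeff i) :
    {h' : ℤ[X] | h'.Monic ∧ h'.natDegree = 2 * g ∧
        (∀ i j, i + j = 2 * g → (q : ℤ) ^ g * h'.coeff j = (q : ℤ) ^ i * h'.coeff i) ∧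
        weilWindowForm (q : ℝ) h' M = weilWindowForm (q : ℝ) h M}.Infinite := by
  have hbij := fibre_bijOn_readout hq hM hh hdeg hFE
  haveI : Nonempty (Finset.Ioc M g) := ⟨⟨g, Finset.mem_Ioc.2 ⟨by omega, le_rfl⟩⟩⟩
  refine Set.Infinite.of_image (fun h' : ℤ[X] => fun k : Finset.Ioc M g => h'.coeff (2 * g - k)) ?_
  rw [hbij.image_eq]
  exact Set.infinite_univ

/-- … while its RH-true part is FINITE (any `M`). [folklore] -/
theorem fibre_ffRH_finite (q g M : ℕ) (h : ℤ[X]) :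
    {h' : ℤ[X] | (h'.Monic ∧ h'.natDegree = 2 * g ∧
        (∀ i j, i + j = 2 * g → (q : ℤ) ^ g * h'.coeff j = (q : ℤ) ^ i * h'.coeff i) ∧
        weilWindowForm (q : ℝ) h' M = weilWindowForm (q : ℝ) h M) ∧
        ∀ α ∈ frobRoots h', ‖α‖ = Real.sqrt q}.Finite :=
  (setOf_ffRH_finite q g).subset fun _ ⟨⟨hm, hd, _, _⟩, hRH⟩ => ⟨hm, hd, hRH⟩

/-- Quantitatively: an RH-true member of the fibre has its readout in the Weil box
`|c_{2g-k}| ≤ C(2g, 2g-k) q^{k/2}`. [folklore] -/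
theorem abs_readout_le_of_ffRH {q : ℕ} {h' : ℤ[X]} {g : ℕ} (hh' : h'.Monic) (hdeg' : h'.natDegree = 2 * g)
    (hRH : ∀ α ∈ frobRoots h', ‖α‖ = Real.sqrt q) {k : ℕ} (hk : k ≤ 2 * g) :
    |(h'.coeff (2 * g - k) : ℝ)| ≤ ((2 * g).choose (2 * g - k) : ℝ) * Real.sqrt q ^ k := by
  have e := abs_coeff_le_of_ffRH hh' hdeg' hRH (k := 2 * g - k) (Nat.sub_le _ _)
  rwa [show 2 * g - (2 * g - k) = k by omega] at e

/-- A depth-`M` window-local reader that accepts one member of a fibre accepts the whole fibre (any `q`). [folklore] -/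
theorem finiteWindow_accepts_fibre {Φ : Tower → Prop} {M : ℕ}
    (hloc : ∀ T T' : Tower, (∀ M' ≤ M, T M' = T' M') → Φ T → Φ T')
    {q : ℝ} {h h' : ℤ[X]} (hT : weilWindowForm q h' M = weilWindowForm q h M)
    (hΦ : Φ (weilWindowTower q h)) : Φ (weilWindowTower q h') :=
  hloc _ _ (fun _ hM' => weilWindowForm_eq_of_le hM' hT.symm) hΦ

/-- In the honest fibre of an ACCEPTED datum, the members that are NOT (RH-false and accepted) form a finite set
(they are RH-true). [folklore] -/
theorem finiteWindow_fibre_fakes_cofinite {Φ : Tower → Prop} {M : ℕ}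
    (hloc : ∀ T T' : Tower, (∀ M' ≤ M, T M' = T' M') → Φ T → Φ T')
    {q : ℕ} {g : ℕ} {h : ℤ[X]} (hΦ : Φ (weilWindowTower (q : ℝ) h)) :
    {h' : ℤ[X] | (h'.Monic ∧ h'.natDegree = 2 * g ∧
        (∀ i j, i + j = 2 * g → (q : ℤ) ^ g * h'.coeff j = (q : ℤ) ^ i * h'.coeff i) ∧
        weilWindowForm (q : ℝ) h' M = weilWindowForm (q : ℝ) h M) ∧
        ¬ ((¬ ∀ α ∈ frobRoots h', ‖α‖ = Real.sqrt q) ∧ Φ (weilWindowTower (q : ℝ) h'))}.Finite := by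
  refine (setOf_ffRH_finite q g).subset ?_
  rintro h' ⟨⟨hm, hd, -, hT⟩, hnot⟩
  refine ⟨hm, hd, ?_⟩
  by_contra hRH
  exact hnot ⟨hRH, finiteWindow_accepts_fibre hloc hT hΦ⟩

/-- FF-DOOR (i), FINITE-WINDOW HALF, FULL-FIBRE DENSITY FORM: let `Φ` be ANY window-local predicate of depth `M`
(a functional of the windows `T_0, …, T_M`), and let it accept ONE honest datum `h` (monic, degree `2g`,
coefficient FE) of dimension `g ≥ M + 1` at `q > 0`.  Then `Φ` accepts INFINITELY MANY honest, RH-FALSE data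
`h'` having exactly the same windows `T_0, …, T_M` as `h` — indeed all but finitely many of the `ℤ^{g-M}` honest
data in the fibre of `h` (`fibre_bijOn_readout`, `finiteWindow_fibre_fakes_cofinite`).  No finite window prefix
certifies RH on honest data, fibre by fibre and with density one. [folklore] -/
theorem ffDoor_fibre_density {Φ : Tower → Prop} {M : ℕ}
    (hloc : ∀ T T' : Tower, (∀ M' ≤ M, T M' = T' M') → Φ T → Φ T')
    {q : ℕ} (hq : 0 < q) {g : ℕ} (hM : M + 1 ≤ g) {h : ℤ[X]} (hh : h.Monic) (hdeg : h.natDegree = 2 * g)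
    (hFE : ∀ i j, i + j = 2 * g → (q : ℤ) ^ g * h.coeff j = (q : ℤ) ^ i * h.coeff i)
    (hΦ : Φ (weilWindowTower (q : ℝ) h)) :
    {h' : ℤ[X] | h'.Monic ∧ h'.natDegree = 2 * g ∧
        (∀ i j, i + j = 2 * g → (q : ℤ) ^ g * h'.coeff j = (q : ℤ) ^ i * h'.coeff i) ∧
        weilWindowForm (q : ℝ) h' M = weilWindowForm (q : ℝ) h M ∧
        (¬ ∀ α ∈ frobRoots h', ‖α‖ = Real.sqrt q) ∧ Φ (weilWindowTower (q : ℝ) h')}.Infinite := by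
  refine ((fibre_infinite hq hM hh hdeg hFE).sdiff (finiteWindow_fibre_fakes_cofinite hloc hΦ (g := g))).mono ?_
  rintro h' ⟨hF, hnot⟩
  have h2 : (¬ ∀ α ∈ frobRoots h', ‖α‖ = Real.sqrt q) ∧ Φ (weilWindowTower (q : ℝ) h') := by
    by_contra hc
    exact hnot ⟨hF, hc⟩
  exact ⟨hF.1, hF.2.1, hF.2.2.1, hF.2.2.2, h2.1, h2.2⟩

end Summit.RiemannHypothesis.RiemannHypothesis.Theorems.MotivicDoor.FunctionField

end
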